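import Mathlib
import HarnessLib
import Summits.ResolutionOfSingularities.ResolutionOfSingularities.Theorems.WildQuotientsWildQuotientResolutionS1aCoarseChartIdentity
import Summits.ResolutionOfSingularities.ResolutionOfSingularities.Theorems.WildQuotientsWildQuotientResolutionS1aGradedLocalization
import Summits.ResolutionOfSingularities.ResolutionOfSingularities.Theorems.WildQuotientsWildQuotientResolutionS1aReesBigrading

/-!
# S1a — the Rees BIGRADING of the chart ring `R^w[(b T^d)⁻¹]` and «bidegree `(0,0)` = the coarse chart»

[OURS · L1 W4.5c · lead-1 g6] — NOT a statement of the manuscript; counted 0; AI-level work, weaker than expert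
review. Crux stmt-ResolutionOfSingularities-17941 (`WildQuotients.CyclicQuotientFourfolds`), line `s1a-logminvertex`,
stub `stub_localGame` (producer): H3 `ChartClause` asks for a `ℤ × ι`-grading `𝒜ʼ` of the chart ring
`Localization.Away h`, `h = b T^d`, which IS the Rees bigrading, and H4a/H4c (memo (G1b)) assert that its
bidegree-`(0,0)` part is the COARSE CHART `CoarseChart.coarseChart` (= the affine blow-up algebra `𝒜₀[K d/b]`,
`…S1aCoarseChartIdentity` p575582). This file assembles both from the generic tools
`…S1aGradedLocalization` (p576317) and `…S1aReesBigrading`: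

* `coverElement_mem_reesPiece` — `h = b T^d` has bidegree `(d, 0)` (`b ∈ 𝒜 0`);
* `chartGrading 𝒜 f w hf d b hb : ℤ × ι → AddSubgroup (ChartRing 𝒜 f w d b hb)` and the `GradedRing` structure
  `chartGradedRing` (noncomputable);
* PINS (anti-costume, the `ChartClause` conjunct verbatim): `algebraMap_mk_mem_chartGrading` — the image of
  `b' T^{d'}` (`b' ∈ 𝒜 δ'`) has bidegree `(d', δ')`; `algebraMap_mem_chartGrading`; `invSelf_mem_chartGrading`
  (`h⁻¹` has bidegree `(-d, 0)`);
* **`chartGrading_zero_eq_coarseChart`** — for a VERONESE degree `d` (H4a `VeroneseNormalised`, (G1a) PROVED in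
  `…S1aVeroneseNormalisation`), `chartGrading … (0, 0) = (coarseChart 𝒜 f w d b hb).toAddSubgroup`:
  `⊇` because the generators `y/1`, `x T^d/h` are bihomogeneous of bidegree `(0,0)`; `⊆` because a bidegree-`(0,0)`
  fraction is `y T^{dm}/hᵐ` with `y ∈ K (d m)` and `mk'_mem_coarseChart_of_veronese` applies.
-/

set_option linter.dupNamespace false

noncomputable section

open DirectSum Literature.AlgebraicGeometry.Resolution
open scoped LaurentPolynomial
open Summit.ResolutionOfSingularities.ResolutionOfSingularities.Theorems.WildQuotientResolution.S1.GradedLocalization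
open Summit.ResolutionOfSingularities.ResolutionOfSingularities.Theorems.WildQuotientResolution.S1.ReesBigrading

namespace Summit.ResolutionOfSingularities.ResolutionOfSingularities.Theorems.WildQuotientResolution.S1.CoarseChart

universe u v

variable {ι : Type v} [AddCommGroup ι] [DecidableEq ι] {B : Type u} [CommRing B]
  (𝒜 : ι → AddSubgroup B) [GradedRing 𝒜] {c : ℕ} (f : Fin c → B) {δ : Fin c → ι} (w : Fin c → ℕ)
  (hf : ∀ i, f i ∈ 𝒜 (δ i)) (d : ℕ) (b : ↥(𝒜 0)) (hb : b ∈ (traceFiltration 𝒜 f w).ideal d)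

/-- The cover element `h = b T^d` has bidegree `(d, 0)`. -/
theorem coverElement_mem_reesPiece : coverElement 𝒜 f w d b hb ∈ reesPiece 𝒜 f w ((d : ℤ), (0 : ι)) :=
  mk_mem_reesPiece 𝒜 f w b.2 _

/-- **The Rees bigrading of the chart ring** `R^w[(b T^d)⁻¹]`: bidegree-`(n, i)` fractions `z / hᵐ` with `z ∈ R^w`
bihomogeneous of bidegree `(n + m d, i)`. [OURS · L1 W4.5c] -/
def chartGrading : ℤ × ι → AddSubgroup (ChartRing 𝒜 f w d b hb) :=
  letI := reesGradedRing 𝒜 f w hf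
  locPiece (reesPiece 𝒜 f w) (coverElement_mem_reesPiece 𝒜 f w d b hb)

/-- **The chart ring is a `ℤ × ι`-graded ring.** [OURS · L1 W4.5c] -/
@[implicit_reducible]
def chartGradedRing : GradedRing (chartGrading 𝒜 f w hf d b hb) :=
  letI := reesGradedRing 𝒜 f w hf
  locGradedRing (reesPiece 𝒜 f w) (coverElement_mem_reesPiece 𝒜 f w d b hb)

/-- Normal form of the bidegree-`e` elements of the chart ring. -/
theorem mem_chartGrading_iff {e : ℤ × ι} {y : ChartRing 𝒜 f w d b hb} :
    y ∈ chartGrading 𝒜 f w hf d b hb e ↔ ∃ (m : ℕ) (z : ↥(cobordantAlgebra f w)),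
      z ∈ reesPiece 𝒜 f w (e + m • ((d : ℤ), (0 : ι))) ∧
      y = algebraMap _ (ChartRing 𝒜 f w d b hb) z * IsLocalization.Away.invSelf (coverElement 𝒜 f w d b hb) ^ m :=
  Iff.rfl

/-- PIN (`ChartClause`, verbatim shape): the image of `b' T^{d'} ∈ R^w`, `b' ∈ 𝒜 δ'`, has bidegree `(d', δ')`. -/
theorem algebraMap_mk_mem_chartGrading (d' : ℤ) (δ' : ι) (b' : B) (hb' : b' ∈ 𝒜 δ')
    (hmem' : LaurentPolynomial.C b' * LaurentPolynomial.T d' ∈ cobordantAlgebra f w) :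
    algebraMap (↥(cobordantAlgebra f w)) (ChartRing 𝒜 f w d b hb) ⟨_, hmem'⟩ ∈ chartGrading 𝒜 f w hf d b hb (d', δ') :=
  letI := reesGradedRing 𝒜 f w hf
  algebraMap_mem_locPiece _ _ (mk_mem_reesPiece 𝒜 f w hb' hmem')

/-- PIN: the structure map `R^w → R^w[h⁻¹]` is bigraded. -/
theorem algebraMap_mem_chartGrading {e : ℤ × ι} {z : ↥(cobordantAlgebra f w)} (hz : z ∈ reesPiece 𝒜 f w e) :
    algebraMap _ (ChartRing 𝒜 f w d b hb) z ∈ chartGrading 𝒜 f w hf d b hb e :=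
  letI := reesGradedRing 𝒜 f w hf
  algebraMap_mem_locPiece _ _ hz

/-- PIN: `h⁻¹` has bidegree `(-d, 0)`. -/
theorem invSelf_mem_chartGrading :
    IsLocalization.Away.invSelf (coverElement 𝒜 f w d b hb) ∈ chartGrading 𝒜 f w hf d b hb (-(d : ℤ), 0) := by
  letI := reesGradedRing 𝒜 f w hf
  have := invSelf_mem_locPiece (reesPiece 𝒜 f w) (coverElement_mem_reesPiece 𝒜 f w d b hb)
  rwa [Prod.neg_mk, neg_zero] at this

/-! ## Bidegree `(0, 0)` is the coarse chart -/

/-- `z/hᵐ` as an `IsLocalization.mk'`. -/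
theorem algebraMap_mul_invSelf_pow_eq_mk' (z : ↥(cobordantAlgebra f w)) (m : ℕ) :
    algebraMap _ (ChartRing 𝒜 f w d b hb) z * IsLocalization.Away.invSelf (coverElement 𝒜 f w d b hb) ^ m =
      IsLocalization.mk' (ChartRing 𝒜 f w d b hb) z
        (⟨coverElement 𝒜 f w d b hb ^ m, m, rfl⟩ : Submonoid.powers (coverElement 𝒜 f w d b hb)) := by
  rw [IsLocalization.eq_mk'_iff_mul_eq]
  have h1 : IsLocalization.Away.invSelf (coverElement 𝒜 f w d b hb) *
      algebraMap _ (ChartRing 𝒜 f w d b hb) (coverElement 𝒜 f w d b hb) = 1 := by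
    rw [mul_comm]; exact IsLocalization.Away.mul_invSelf _
  change _ * algebraMap _ (ChartRing 𝒜 f w d b hb) (coverElement 𝒜 f w d b hb ^ m) = _
  rw [map_pow, mul_assoc, ← mul_pow, h1, one_pow, mul_one]

/-- A bihomogeneous element of `R^w` of bidegree `(n, 0)` with `n = d m ≥ 0` is a cover-type element `y T^{dm}`,
`y ∈ K (d m)`. -/
theorem exists_eq_coverElement_of_mem_reesPiece {m : ℕ} {z : ↥(cobordantAlgebra f w)}
    (hz : z ∈ reesPiece 𝒜 f w (((d * m : ℕ) : ℤ), (0 : ι))) :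
    ∃ (y : ↥(𝒜 0)) (hy : y ∈ (traceFiltration 𝒜 f w).ideal (d * m)), z = coverElement 𝒜 f w (d * m) y hy := by
  obtain ⟨x, hx, hzx⟩ := hz
  have hxJ : x ∈ (weightedFiltration f w).ideal (d * m) := by
    have hmem : LaurentPolynomial.C x * LaurentPolynomial.T ((d * m : ℕ) : ℤ) ∈ cobordantAlgebra f w := hzx ▸ z.2
    exact ((C_mul_T_mem_iff f w).mp hmem) (d * m) rfl
  exact ⟨⟨x, hx⟩, (mem_traceFiltration_iff 𝒜 f w).mpr hxJ, Subtype.ext (by rw [hzx, coe_coverElement])⟩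

/-- **Bidegree `(0,0)` = the coarse chart** (for a Veronese degree `d`). [OURS · L1 W4.5c] -/
theorem chartGrading_zero_eq_coarseChart (hd : VeroneseNormalised 𝒜 f w d) :
    chartGrading 𝒜 f w hf d b hb (0, 0) = (coarseChart 𝒜 f w d b hb).toAddSubgroup := by
  letI := reesGradedRing 𝒜 f w hf
  letI := chartGradedRing 𝒜 f w hf d b hb
  apply le_antisymm
  · -- a bidegree-`(0,0)` fraction is `y T^{dm} / hᵐ` with `y ∈ K (d m)`
    intro y hy
    obtain ⟨m, z, hz, rfl⟩ := (mem_chartGrading_iff 𝒜 f w hf d b hb).mp hy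
    have hz' : z ∈ reesPiece 𝒜 f w (((d * m : ℕ) : ℤ), (0 : ι)) := by
      convert hz using 2
      ext <;> simp [Prod.smul_mk, mul_comm]
    obtain ⟨x, hx, rfl⟩ := exists_eq_coverElement_of_mem_reesPiece 𝒜 f w d hz'
    rw [algebraMap_mul_invSelf_pow_eq_mk']
    exact mk'_mem_coarseChart_of_veronese 𝒜 f w d b hb hd m hx
  · -- the generators of the coarse chart are bihomogeneous of bidegree `(0,0)`
    let S0 : Subring (ChartRing 𝒜 f w d b hb) :=
      { carrier := chartGrading 𝒜 f w hf d b hb (0, 0)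
        mul_mem' := fun {x y} hx hy => by
          have := SetLike.mul_mem_graded (A := chartGrading 𝒜 f w hf d b hb) hx hy
          rwa [Prod.mk_add_mk, add_zero, add_zero] at this
        one_mem' := SetLike.one_mem_graded (chartGrading 𝒜 f w hf d b hb)
        add_mem' := fun hx hy => add_mem hx hy
        zero_mem' := zero_mem _
        neg_mem' := fun hx => neg_mem hx }
    change coarseChart 𝒜 f w d b hb ≤ S0
    rw [coarseChart, Subring.closure_le]
    rintro y (⟨r, rfl⟩ | ⟨x, hx, rfl⟩)
    · -- `toChartRing r = (C r)/1`, `C r ∈ R^w` of bidegree `(0, 0)`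
      change toChartRing 𝒜 f w d b hb r ∈ chartGrading 𝒜 f w hf d b hb (0, 0)
      rw [toChartRing_apply]
      exact algebraMap_mem_chartGrading 𝒜 f w hf d b hb (algebraMap_mem_reesPiece 𝒜 f w r.2)
    · -- `x T^d / h`, `x T^d` of bidegree `(d, 0) = (0,0) + 1 • (d, 0)`
      change chartFraction 𝒜 f w d b hb x hx ∈ chartGrading 𝒜 f w hf d b hb (0, 0)
      have h1 : chartFraction 𝒜 f w d b hb x hx = algebraMap _ (ChartRing 𝒜 f w d b hb) (coverElement 𝒜 f w d x hx) *
          IsLocalization.Away.invSelf (coverElement 𝒜 f w d b hb) ^ 1 := by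
        rw [algebraMap_mul_invSelf_pow_eq_mk', chartFraction]
        congr 1
        exact Subtype.ext (pow_one _).symm
      rw [h1]
      refine mk_mem_locPiece _ _ 1 ?_
      rw [one_nsmul, Prod.mk_add_mk, zero_add, zero_add]
      exact coverElement_mem_reesPiece 𝒜 f w d x hx

end Summit.ResolutionOfSingularities.ResolutionOfSingularities.Theorems.WildQuotientResolution.S1.CoarseChart

end
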